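import Summits.ABC.ABC.Theorems.TwistAmplificationSharpModerateLawUniformityDischarge
import Summits.ABC.ABC.Theorems.TwistAmplificationSharpModerateLawCornerHallToHallRegime
import Summits.ABC.ABC.Theorems.TwistAmplificationSharpModerateLawThickReduction
import Summits.ABC.ABC.Theorems.TwistAmplificationSharpModerateLawAbcOfThickMissing

/-!
# Crux `TwistAmplification.SharpModerateLaw` (stmt-ABC-1975), line `unit-plane-conic-two-torsion`:
the cross-line residue map CENSUS ⇒ DISPERSION (`IndexFormShellLawCone → CuspLawD`, `SpreadLawCone → ABC`)

Worker of lead `prover-line-stmt-ABC-1975-c4-0` (stub `stub_ringCensus : RingCensus6`, which stays OPEN: a count of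
maximal cubic rings with a small-height datum by radical of the discriminant; uniform Thue–Mahler per ring gives
`X^{1+ε}Y^{ε}`, short of the law by `Y^{1/6}`).  What IS provable is the map from the common open core of the two
CENSUS lines (`SpreadLawCone ↔ IndexFormShellLawCone ↔ D1 ∧ D2 ∧ E′`) to the cores of the DISPERSION line
(`deep-moduli-cusp-dispersion`: `CuspLawD`, `LawOn P`), all over landed files:

* §1 `CuspDispersion.ncard_cuspSetD_le` (`#cuspSetD X Y ≤ totalCount ⊤ X (93312·Y) + totalCount ⊤ X (186624·Y)`: the
  landed cover `cuspSetD X Y ⊆ cuspShell X (Y/2) ∪ cuspShell X Y` of the Hall worker (`UnitPlane.cuspShell_or_of_mem_cuspSetD`,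
  `…CornerHallToHallRegime.lean`: level `M⁺ ∈ (Y/2, Y)` resp. `M⁺ = Y`, `N5cusp ≤ N*`) and the landed injection
  `ncard_cuspShell_le` at both levels), `CuspDispersion.lawOn_of_cuspLawD` (`CuspLawD → LawOn P`, monotonicity);
* §2 **`cuspLawD_of_indexFormShellLawCone : IndexFormShellLawCone → CuspLawD`** (registered sub-goal): the cone
  `X³ ≤ 8Y ≤ 8X^σ` of `CuspLawD` maps into the index-form cone at `Y' ∈ {93312Y, 186624Y}` (`X³ ≤ 8Y ≤ 2Y'`,
  `Y' ≤ 186624X^σ`), the law is applied with exponent `ε/(σ+1)` (`(XY')^{ε/(σ+1)} ≤ 186624^{ε/(σ+1)}·X^ε` as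
  `XY' ≤ 186624·X^{σ+1}`) and `Y'^{-1/6} ≤ Y^{-1/6}`; constant `2·max(C,0)·186624^{ε/(σ+1)}`;
* §3 corollaries: `cuspLawD_of_spreadLawCone`, `lawOn_of_spreadLawCone` (every restricted law of the dispersion line,
  in particular its three open twist-aware regime laws `LawOn ResolvedRegimeTw / DeepRegimeTw / HallRegimeTw` and c2's
  unified thick core `LawOn ThickTw`), and the headline **`abc_of_spreadLawCone : SpreadLawCone → ABC`** (registered
  sub-goal; via c2's `abc_of_lawOn_thickTw`) — the census lines' one common open core implies the SUMMIT — together with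
  `abc_of_indexFormShellLawCone` and `UnitPlane.abc_of_unitPlaneResidue : LawWithConeE SpreadDeep6 1 → RingCensus6 →
  CornerHallLaw6 → ABC` (the three open unit-plane stubs imply the summit; the lead's `indexFormShellLawCone_of_residue`).

(C) ALIGNMENT OF THE HALL CUTS (`ThickTw` of the dispersion line vs `¬CornerHallTw` of this line; no theorem).  Since
`432² = 186624`, the v3 corner `|Disc F|·m²·g³ ≤ 432√(2Y')` at the index-form level `Y' = 186624·Y''` of the image of a
cusp pair of cusp level `Y''` reads `|c₄³ − c₆²| ≤ 1728·√(2Y'')·g³` (`|Disc F|·m²·g⁶ = 108|c₄³ − c₆²|`), i.e. EXACTLY the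
sibling's cut `1728√Y·d³` with `d = g` on the generic shell `Y'' = Y/2` of `cuspSetD X Y` (on the boundary shell
`M⁺ = Y`, `Y'' = Y`, the corner is wider by `√2`); so `HallRegimeTw ⟹ CornerHallTw` of the datum (every twist divisor
divides `g`; the Hall worker's `cornerHallTw_of_twistData`).  But the content `g` is NOT a twist divisor in general: from
`g² ∣ 9c₄`, `g³ ∣ 54c₆` (`contentOK_of_data`) only `d₀ = g'·2^{(a−1)⁺}·3^{(b−1)⁺}` (`g = 2^a3^bg'`, `(g', 6) = 1`) has
`d₀² ∣ c₄ ∧ d₀³ ∣ c₆`, with `g ∣ 6d₀`, and the defect occurs (11a3: `(c₄, c₆) = (16, −152)`, `ω₀ = ±(6f − 4)` with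
`f³ − 2f² + 2 = 0`, `ℤ[f]` maximal of discriminant `−44`, so `g = 6`, `m = 1`, while the twist divisors of `(16, −152)`
are `{1, 2}`); hence `ThickTw Y x` only yields `|c₄³ − c₆²| > 1728√Y·(g/6)³` and misses `¬CornerHallTw` by the factor
`(g/d)³ ∣ 216 = 2³3³` (`d` the largest twist divisor; `27` for 11a3), so `D1 ∧ D2` (+ the proved few-deep law) do NOT
formally give `LawOn ThickTw`: the slab `1728√Y·d³ < |c₄³ − c₆²| ≤ 1728√(2Y)·g³` is charged to the thick stubs by the
dispersion line and to the Hall corner E′ by this line (re-cutting `CornerHallTw` with `d` in place of `g` would align them).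
-/

noncomputable section

-- the mandated summit namespace `Summit.ABC.ABC` (summit = problem) trips the duplicate-namespace linter
set_option linter.dupNamespace false

namespace Summit.ABC.ABC.Theorems.SharpModerateLaw

open Literature.NumberTheory.CubicFields
open scoped BigOperators

/-! ## 1. Counting the dyadic cusp set by the two cusp shells -/

namespace CuspDispersion

/-- **`#cuspSetD X Y ≤ totalCount ⊤ X (186624·(Y/2)) + totalCount ⊤ X (186624·Y)`**: the cover
`cuspSetD X Y ⊆ cuspShell X (Y/2) ∪ cuspShell X Y` (`UnitPlane.cuspShell_or_of_mem_cuspSetD`) and the landed injection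
`ncard_cuspShell_le` at the two levels (the shells are finite, `cuspShell_finite`). -/
theorem ncard_cuspSetD_le (X Y : ℝ) :
    (cuspSetD X Y).ncard ≤ totalCount (fun _ _ _ _ => True) X (186624 * (Y / 2)) +
      totalCount (fun _ _ _ _ => True) X (186624 * Y) := by
  have hsub : cuspSetD X Y ⊆ cuspShell X (Y / 2) ∪ cuspShell X Y := fun x hx =>
    UnitPlane.cuspShell_or_of_mem_cuspSetD hx
  calc (cuspSetD X Y).ncard ≤ (cuspShell X (Y / 2) ∪ cuspShell X Y).ncard :=
        Set.ncard_le_ncard hsub ((cuspShell_finite X _).union (cuspShell_finite X Y))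
    _ ≤ (cuspShell X (Y / 2)).ncard + (cuspShell X Y).ncard := Set.ncard_union_le _ _
    _ ≤ _ := add_le_add (ncard_cuspShell_le X (Y / 2)) (ncard_cuspShell_le X Y)

/-- `CuspLawD → LawOn P` for every predicate (the `P`-part of the cusp set is a subset; `cuspSetD_finite`). -/
theorem lawOn_of_cuspLawD (P : ℝ → ℤ × ℤ → Prop) (h : CuspLawD) : LawOn P := by
  intro σ hσ ε hε
  obtain ⟨C, hC⟩ := h σ hσ ε hε
  refine ⟨C, fun X Y hX hY hXY hYX => le_trans ?_ (hC X Y hX hY hXY hYX)⟩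
  have hsub : {x : ℤ × ℤ | x ∈ cuspSetD X Y ∧ P Y x} ⊆ cuspSetD X Y := fun x hx => hx.1
  exact_mod_cast Set.ncard_le_ncard hsub (cuspSetD_finite X Y hY)

end CuspDispersion

/-! ## 2. The census core gives the dispersion core -/

/-- **`cuspLawD_of_indexFormShellLawCone`** (registered sub-goal of stmt-ABC-1975): the cone index-form shell law (the common
open core of both census lines) implies the dispersion line's transfer target C⁺′ = `CuspLawD`, with constant
`2·max(C,0)·186624^{ε/(σ+1)}` where `C = C(σ, ε/(σ+1))` is the constant of the shell law. -/
theorem cuspLawD_of_indexFormShellLawCone : IndexFormShellLawCone → Summit.ABC.ABC.Theorems.SharpModerateLaw.CuspDispersion.CuspLawD := by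
  intro hIF σ hσ ε hε
  have hσ1 : 0 < σ + 1 := by linarith
  set δ : ℝ := ε / (σ + 1) with hδ
  have hδ0 : 0 < δ := div_pos hε hσ1
  obtain ⟨C, hC⟩ := hIF σ hσ δ hδ0
  refine ⟨2 * (max C 0 * (186624 : ℝ) ^ δ), fun X Y hX hY hXY hYX => ?_⟩
  have hX0 : 0 < X := by linarith
  have hY0 : 0 < Y := by linarith
  -- the shell law at a level `Y'` with `4Y ≤ Y' ≤ 186624·Y`
  have key : ∀ Y' : ℝ, 4 * Y ≤ Y' → Y' ≤ 186624 * Y →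
      (totalCount (fun _ _ _ _ => True) X Y' : ℝ) ≤
        max C 0 * (186624 : ℝ) ^ δ * X ^ ε * (X * Y ^ (-(1 / 6 : ℝ)) + 1) := by
    intro Y' h4 h186
    have hYY' : Y ≤ Y' := by linarith
    have hY'0 : 0 < Y' := by linarith
    have hc1 : X ^ 3 ≤ 2 * Y' := by linarith
    have hc2 : Y' ≤ 186624 * X ^ σ := by linarith
    have h1 := hC X Y' hX (by linarith) hc1 hc2
    have e1 : (X * Y') ^ δ ≤ (186624 : ℝ) ^ δ * X ^ ε := by
      have hXσ : X ^ (σ + 1) = X ^ σ * X := by rw [Real.rpow_add hX0, Real.rpow_one]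
      have hle : X * Y' ≤ 186624 * X ^ (σ + 1) := by
        rw [hXσ]; nlinarith [mul_le_mul_of_nonneg_left hc2 hX0.le]
      calc (X * Y') ^ δ ≤ (186624 * X ^ (σ + 1)) ^ δ := Real.rpow_le_rpow (by positivity) hle hδ0.le
        _ = (186624 : ℝ) ^ δ * (X ^ (σ + 1)) ^ δ := Real.mul_rpow (by norm_num) (by positivity)
        _ = (186624 : ℝ) ^ δ * X ^ ε := by
            rw [← Real.rpow_mul hX0.le]
            congr 2
            rw [hδ]; field_simp
    have e2 : Y' ^ (-(1 / 6 : ℝ)) ≤ Y ^ (-(1 / 6 : ℝ)) := Real.rpow_le_rpow_of_nonpos hY0 hYY' (by norm_num)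
    have hE : 0 ≤ (X * Y') ^ δ := Real.rpow_nonneg (by positivity) _
    have hA : 0 ≤ X * Y' ^ (-(1 / 6 : ℝ)) + 1 := by positivity
    have hA' : X * Y' ^ (-(1 / 6 : ℝ)) + 1 ≤ X * Y ^ (-(1 / 6 : ℝ)) + 1 := by
      nlinarith [mul_le_mul_of_nonneg_left e2 hX0.le]
    have hB : 0 ≤ X * Y ^ (-(1 / 6 : ℝ)) + 1 := by positivity
    calc (totalCount (fun _ _ _ _ => True) X Y' : ℝ)
        ≤ C * (X * Y') ^ δ * (X * Y' ^ (-(1 / 6 : ℝ)) + 1) := h1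
      _ ≤ max C 0 * (X * Y') ^ δ * (X * Y ^ (-(1 / 6 : ℝ)) + 1) :=
          mul_le_mul (mul_le_mul_of_nonneg_right (le_max_left _ _) hE) hA' hA (mul_nonneg (le_max_right _ _) hE)
      _ ≤ max C 0 * ((186624 : ℝ) ^ δ * X ^ ε) * (X * Y ^ (-(1 / 6 : ℝ)) + 1) :=
          mul_le_mul_of_nonneg_right (mul_le_mul_of_nonneg_left e1 (le_max_right _ _)) hB
      _ = max C 0 * (186624 : ℝ) ^ δ * X ^ ε * (X * Y ^ (-(1 / 6 : ℝ)) + 1) := by ring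
  have hcount : ((CuspDispersion.cuspSetD X Y).ncard : ℝ) ≤ (totalCount (fun _ _ _ _ => True) X (186624 * (Y / 2)) : ℝ) +
      (totalCount (fun _ _ _ _ => True) X (186624 * Y) : ℝ) := by
    exact_mod_cast CuspDispersion.ncard_cuspSetD_le X Y
  have k1 := key (186624 * (Y / 2)) (by linarith) (by linarith)
  have k2 := key (186624 * Y) (by linarith) le_rfl
  calc ((CuspDispersion.cuspSetD X Y).ncard : ℝ)
      ≤ (totalCount (fun _ _ _ _ => True) X (186624 * (Y / 2)) : ℝ) +
          (totalCount (fun _ _ _ _ => True) X (186624 * Y) : ℝ) := hcount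
    _ ≤ max C 0 * (186624 : ℝ) ^ δ * X ^ ε * (X * Y ^ (-(1 / 6 : ℝ)) + 1) +
          max C 0 * (186624 : ℝ) ^ δ * X ^ ε * (X * Y ^ (-(1 / 6 : ℝ)) + 1) := add_le_add k1 k2
    _ = 2 * (max C 0 * (186624 : ℝ) ^ δ) * X ^ ε * (X * Y ^ (-(1 / 6 : ℝ)) + 1) := by ring

/-! ## 3. Corollaries: the census core gives every dispersion core, and the summit -/

/-- **`SpreadLawCone → CuspLawD`**: the census lines' open core gives the dispersion line's transfer target (cone split
with the proved few-deep law: the lead's `indexFormShellLawCone_of_spreadLawCone`, `…UniformityDischarge.lean`). -/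
theorem cuspLawD_of_spreadLawCone (h : SpreadLawCone) : CuspDispersion.CuspLawD :=
  cuspLawD_of_indexFormShellLawCone (indexFormShellLawCone_of_spreadLawCone h)

/-- `IndexFormShellLawCone → LawOn P` for every predicate `P`. -/
theorem lawOn_of_indexFormShellLawCone (P : ℝ → ℤ × ℤ → Prop) (h : IndexFormShellLawCone) :
    CuspDispersion.LawOn P :=
  CuspDispersion.lawOn_of_cuspLawD P (cuspLawD_of_indexFormShellLawCone h)

/-- **`SpreadLawCone → LawOn P`** for every predicate `P`: each restricted law of the dispersion line follows from the
census core. -/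
theorem lawOn_of_spreadLawCone (P : ℝ → ℤ × ℤ → Prop) (h : SpreadLawCone) : CuspDispersion.LawOn P :=
  CuspDispersion.lawOn_of_cuspLawD P (cuspLawD_of_spreadLawCone h)

/-- The census core gives the dispersion line's open stub 3 (twist-aware resolved regime). -/
theorem lawOn_resolvedRegimeTw_of_spreadLawCone (h : SpreadLawCone) :
    CuspDispersion.LawOn CuspDispersion.ResolvedRegimeTw :=
  lawOn_of_spreadLawCone _ h

/-- The census core gives the dispersion line's open stub 4 (twist-aware deep regime, the hardest). -/
theorem lawOn_deepRegimeTw_of_spreadLawCone (h : SpreadLawCone) :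
    CuspDispersion.LawOn CuspDispersion.DeepRegimeTw :=
  lawOn_of_spreadLawCone _ h

/-- The census core gives the dispersion line's open stub 5 (twist-aware Hall regime). -/
theorem lawOn_hallRegimeTw_of_spreadLawCone (h : SpreadLawCone) :
    CuspDispersion.LawOn CuspDispersion.HallRegimeTw :=
  lawOn_of_spreadLawCone _ h

/-- The census core gives c2's unified thick core `LawOn ThickTw` (↔ `ThickMissingTw`). -/
theorem lawOn_thickTw_of_spreadLawCone (h : SpreadLawCone) : CuspDispersion.LawOn CuspDispersion.ThickTw :=
  lawOn_of_spreadLawCone _ h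

/-- **`IndexFormShellLawCone → ABC`**: the cone index-form shell law implies the summit (through `LawOn ThickTw` and
c2's `abc_of_lawOn_thickTw`). -/
theorem abc_of_indexFormShellLawCone (h : IndexFormShellLawCone) : _root_.ABC :=
  CuspDispersion.abc_of_lawOn_thickTw (lawOn_of_indexFormShellLawCone _ h)

/-- **`abc_of_spreadLawCone`** (registered sub-goal of stmt-ABC-1975): the one common open core of the two census lines
implies the SUMMIT `ABC`. -/
theorem abc_of_spreadLawCone : SpreadLawCone → _root_.ABC :=
  fun h => CuspDispersion.abc_of_lawOn_thickTw (lawOn_thickTw_of_spreadLawCone h)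

namespace UnitPlane

/-- **The three open unit-plane stubs imply the summit**: `LawWithConeE SpreadDeep6 1 → RingCensus6 → CornerHallLaw6 → ABC`
(spread-deep law D1, ring census D2, Hall corner E′ give the cone index-form shell law by `flat6Cover_glue` with the
proved v3 few-deep law — the lead's `UnitPlane.indexFormShellLawCone_of_residue`, `…UniformityDischarge.lean` — and
`abc_of_indexFormShellLawCone` concludes). -/
theorem abc_of_unitPlaneResidue : LawWithConeE SpreadDeep6 1 → RingCensus6 → CornerHallLaw6 → _root_.ABC :=
  fun hD hR hH => abc_of_indexFormShellLawCone (indexFormShellLawCone_of_residue hD hR hH)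

/-- The three open unit-plane stubs give the dispersion line's transfer target `CuspLawD`. -/
theorem cuspLawD_of_unitPlaneResidue (hD : LawWithConeE SpreadDeep6 1) (hR : RingCensus6) (hH : CornerHallLaw6) :
    CuspDispersion.CuspLawD :=
  cuspLawD_of_indexFormShellLawCone (indexFormShellLawCone_of_residue hD hR hH)

end UnitPlane

end Summit.ABC.ABC.Theorems.SharpModerateLaw

end
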